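import Literature.Topology.FourManifolds.PairSaddles
import HarnessLib

/-!
# Saddle data for a pair of basin settings: the model conjugations `MC`, `MCi` and swapping

Topic `Literature/Topology/FourManifolds` (support file for the two-field handle-extension
endgame of `stmt-SmoothPoincare4-15190`; continuation of `PairSaddles.lean`).
Everything here is **proved**; no named facts.

For saddle data `Q : P.SaddleData` of a pair of basin settings
(`Literature.Topology.FourManifolds.BasinPair.SaddleData`, `PairSaddles.lean`: Milnor boxes
`DA s`, `DB s` of the two cut-off fields at the saddles, common size `ε`, correspondence `σ`):

* levels in the `3ε`-balls lie within `9ε²` of the common value `c`, hence strictly between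
  the chart sphere and the collar;
* `SaddleData.MC s = (DA s).chartMap (DB (σ s))` — **the model conjugation** from the box of
  `ξ_A` at `s` to the box of `ξ_B` at `σ s` (Milnor 1965, proof of Thm. 3.13: identify the two
  coordinate systems; `MilnorBoxChartMap.lean`): it preserves the coordinates and `g`
  (`coord_MC`, `apply_MC`), is smooth on the `3ε`-ball (`contMDiffAt_MC`), is inverted by
  `MCi` (`MCi_MC`, `MC_MCi`), and **conjugates the two flows** while an orbit stays in the ball
  (`MC_θ`, naturality of flows);
* `SaddleData.swap` — the data for `P.swap`, whose model conjugation is `MCi` (`swap_MC`).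

## References

* J. Milnor, *Lectures on the h-cobordism theorem* (1965), Def. 3.1, proofs of Thms. 3.12–3.13
  (PDF pp. 12, 17–19). [MilnorHCobordism1965]
* J. M. Lee, *Introduction to Smooth Manifolds*, 2nd ed. (2012), Prop. 9.13. [LeeSmoothManifolds2013]
-/

open scoped Manifold ContDiff Topology
open Set Function Filter Metric

noncomputable section

namespace Literature.Topology.FourManifolds

open Cobordism FourManifolds.Flow

universe u

variable {n : ℕ} {W : Type u} [TopologicalSpace W] [T2Space W] [SecondCountableTopology W]
  [CompactSpace W] [ChartedSpace (EuclideanHalfSpace (n + 1)) W] [IsManifold (𝓡∂ (n + 1)) ∞ W]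

namespace BasinPair

variable {g : W → ℝ} {ξA ξB : Π x : W, TangentSpace (𝓡∂ (n + 1)) x} {P : BasinPair g ξA ξB}

namespace SaddleData

variable (Q : P.SaddleData)

/-! ### Basic consequences -/

/-- `sph < c`. [folklore] -/
theorem sph_lt_c : P.A.sph < Q.c := by nlinarith [Q.sph_lt, Q.ε_pos]

/-- `c < 1 - a' < L`. [folklore] -/
theorem c_lt_L : Q.c < P.A.L := by
  have := Q.lt_collar; have := P.A.one_sub_a'_lt_L; nlinarith [Q.ε_pos]

/-- `g p₀ < c`. [folklore] -/
theorem apply_p₀_lt_c : g P.A.p₀ < Q.c := P.A.apply_p₀_lt_sph.trans Q.sph_lt_c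

/-- On the chart domain of an `A`-box, `g = c + Q(u)`. [cite: MilnorHCobordism1965, Def. 3.1 (2) (PDF p. 12)] -/
theorem apply_eq_A (s : SaddlePt n g) {x : W} (hx : x ∈ (Q.DA s).chart.source) :
    g x = Q.c + milnorQuadratic (Q.DA s).k ((Q.DA s).coord x) := by
  rw [(Q.DA s).apply_eq x hx, Q.apply_eq_c s]; rfl

/-- On the chart domain of a `B`-box, `g = c + Q(u)`. [cite: MilnorHCobordism1965, Def. 3.1 (2) (PDF p. 12)] -/
theorem apply_eq_B (s : SaddlePt n g) {x : W} (hx : x ∈ (Q.DB s).chart.source) :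
    g x = Q.c + milnorQuadratic (Q.DB s).k ((Q.DB s).coord x) := by
  rw [(Q.DB s).apply_eq x hx, Q.apply_eq_c s]; rfl

/-- **Levels in the `3ε`-ball of an `A`-box lie within `9ε²` of `c`.** [folklore] -/
theorem abs_apply_sub_c_le_A (s : SaddlePt n g) {x : W} (hx : x ∈ (Q.DA s).chart.source)
    (hxn : ‖(Q.DA s).coord x‖ ≤ 3 * Q.ε) : |g x - Q.c| ≤ 9 * Q.ε ^ 2 := by
  rw [Q.apply_eq_A s hx, add_sub_cancel_left, milnorQuadratic_eq]
  have h1 := sqSumLT_add_sqSumGE (Q.DA s).k ((Q.DA s).coord x)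
  have h2 := sqSumLT_nonneg (Q.DA s).k ((Q.DA s).coord x)
  have h3 := sqSumGE_nonneg (Q.DA s).k ((Q.DA s).coord x)
  have h4 : ‖(Q.DA s).coord x‖ ^ 2 ≤ (3 * Q.ε) ^ 2 := pow_le_pow_left₀ (norm_nonneg _) hxn 2
  rw [abs_le]; constructor <;> nlinarith

/-- Levels in the `3ε`-ball of a `B`-box lie within `9ε²` of `c`. [folklore] -/
theorem abs_apply_sub_c_le_B (s : SaddlePt n g) {x : W} (hx : x ∈ (Q.DB s).chart.source)
    (hxn : ‖(Q.DB s).coord x‖ ≤ 3 * Q.ε) : |g x - Q.c| ≤ 9 * Q.ε ^ 2 := by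
  rw [Q.apply_eq_B s hx, add_sub_cancel_left, milnorQuadratic_eq]
  have h1 := sqSumLT_add_sqSumGE (Q.DB s).k ((Q.DB s).coord x)
  have h2 := sqSumLT_nonneg (Q.DB s).k ((Q.DB s).coord x)
  have h3 := sqSumGE_nonneg (Q.DB s).k ((Q.DB s).coord x)
  have h4 : ‖(Q.DB s).coord x‖ ^ 2 ≤ (3 * Q.ε) ^ 2 := pow_le_pow_left₀ (norm_nonneg _) hxn 2
  rw [abs_le]; constructor <;> nlinarith

/-- Points of the `3ε`-ball of an `A`-box lie strictly between the chart sphere and the collar. [folklore] -/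
theorem apply_mem_Ioo_A (s : SaddlePt n g) {x : W} (hx : x ∈ (Q.DA s).chart.source)
    (hxn : ‖(Q.DA s).coord x‖ ≤ 3 * Q.ε) : g x ∈ Ioo P.A.sph (1 - P.A.S.a') := by
  have h := abs_le.1 (Q.abs_apply_sub_c_le_A s hx hxn)
  exact ⟨by linarith [Q.sph_lt, h.1], by linarith [Q.lt_collar, h.2]⟩

/-- Points of the `3ε`-ball of a `B`-box lie strictly between the chart sphere and the collar. [folklore] -/
theorem apply_mem_Ioo_B (s : SaddlePt n g) {x : W} (hx : x ∈ (Q.DB s).chart.source)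
    (hxn : ‖(Q.DB s).coord x‖ ≤ 3 * Q.ε) : g x ∈ Ioo P.A.sph (1 - P.A.S.a') := by
  have h := abs_le.1 (Q.abs_apply_sub_c_le_B s hx hxn)
  exact ⟨by linarith [Q.sph_lt, h.1], by linarith [Q.lt_collar, h.2]⟩

/-! ### The model conjugations -/

/-- **The model conjugation** from the box of `ξ_A` at `s` to the box of `ξ_B` at `σ s`:
`ψ'_{σ s} ∘ ψ_s⁻¹` in Milnor coordinates. [cite: MilnorHCobordism1965, Def. 3.1 and proof of Thm. 3.13] -/
def MC (s : SaddlePt n g) (x : W) : W := (Q.DA s).chartMap (Q.DB (Q.σ s)) x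

/-- **The inverse model conjugation**, indexed by the `B`-saddle `s'`: from the box of `ξ_B` at
`s'` to the box of `ξ_A` at `σ⁻¹ s'`. [cite: MilnorHCobordism1965, Def. 3.1 and proof of Thm. 3.13] -/
def MCi (s' : SaddlePt n g) (y : W) : W := (Q.DB s').chartMap (Q.DA (Q.σ.symm s')) y

/-- `MC`, unfolded. [folklore] -/
theorem MC_def (s : SaddlePt n g) (x : W) : Q.MC s x = (Q.DA s).chartMap (Q.DB (Q.σ s)) x := rfl

/-- `MCi`, unfolded. [folklore] -/
theorem MCi_def (s' : SaddlePt n g) (y : W) : Q.MCi s' y = (Q.DB s').chartMap (Q.DA (Q.σ.symm s')) y := rfl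

variable {s : SaddlePt n g} {x : W}

/-- `MC` lands in the chart domain of the `B`-box with the same coordinates (`‖u‖ ≤ 3ε`). [folklore] -/
theorem MC_mem_source_and_coord (hxn : ‖(Q.DA s).coord x‖ ≤ 3 * Q.ε) :
    Q.MC s x ∈ (Q.DB (Q.σ s)).chart.source ∧ (Q.DB (Q.σ s)).coord (Q.MC s x) = (Q.DA s).coord x :=
  (Q.DA s).chartMap_mem_source_and_coord _ (by rw [Q.εB]; exact hxn)

/-- **`MC` preserves the coordinates.** [folklore] -/
theorem coord_MC (hxn : ‖(Q.DA s).coord x‖ ≤ 3 * Q.ε) :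
    (Q.DB (Q.σ s)).coord (Q.MC s x) = (Q.DA s).coord x :=
  (Q.MC_mem_source_and_coord hxn).2

/-- `MC` lands in the chart domain. [folklore] -/
theorem MC_mem_source (hxn : ‖(Q.DA s).coord x‖ ≤ 3 * Q.ε) : Q.MC s x ∈ (Q.DB (Q.σ s)).chart.source :=
  (Q.MC_mem_source_and_coord hxn).1

/-- `MC` maps chart balls to chart balls (`R ≤ 3ε`). [folklore] -/
theorem MC_mem_chartBall {R : ℝ} (hR : R ≤ 3 * Q.ε) (hx : x ∈ (Q.DA s).chartBall R) :
    Q.MC s x ∈ (Q.DB (Q.σ s)).chartBall R :=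
  (Q.DA s).chartMap_mem_chartBall _ (by rw [Q.εB]; exact hR) hx

/-- **`MC` preserves `g`** (same normal form, same index, same critical value). [cite: MilnorHCobordism1965, Def. 3.1] -/
theorem apply_MC (hx : x ∈ (Q.DA s).chart.source) (hxn : ‖(Q.DA s).coord x‖ ≤ 3 * Q.ε) : g (Q.MC s x) = g x :=
  (Q.DA s).apply_chartMap_of_eq _ (Q.k_eq s).symm (by rw [Q.apply_eq_c, Q.apply_eq_c]) hx
    (by rw [Q.εB]; exact hxn)

/-- `MC` sends the saddle to the corresponding saddle. [folklore] -/
theorem MC_self (s : SaddlePt n g) : Q.MC s s.1 = (Q.σ s).1 := (Q.DA s).chartMap_self _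

/-- `|x⃗|²` is preserved by `MC`. [folklore] -/
theorem sqSumLT_coord_MC (hxn : ‖(Q.DA s).coord x‖ ≤ 3 * Q.ε) :
    sqSumLT (Q.DB (Q.σ s)).k ((Q.DB (Q.σ s)).coord (Q.MC s x)) = sqSumLT (Q.DA s).k ((Q.DA s).coord x) :=
  (Q.DA s).sqSumLT_coord_chartMap _ (Q.k_eq s).symm (by rw [Q.εB]; exact hxn)

/-- `|y⃗|²` is preserved by `MC`. [folklore] -/
theorem sqSumGE_coord_MC (hxn : ‖(Q.DA s).coord x‖ ≤ 3 * Q.ε) :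
    sqSumGE (Q.DB (Q.σ s)).k ((Q.DB (Q.σ s)).coord (Q.MC s x)) = sqSumGE (Q.DA s).k ((Q.DA s).coord x) :=
  (Q.DA s).sqSumGE_coord_chartMap _ (Q.k_eq s).symm (by rw [Q.εB]; exact hxn)

/-- **`MC` is smooth** at the points of the chart domain with `‖u‖ < 3ε`. [folklore] -/
theorem contMDiffAt_MC (hx : x ∈ (Q.DA s).chart.source) (hxn : ‖(Q.DA s).coord x‖ < 3 * Q.ε) :
    ContMDiffAt (𝓡∂ (n + 1)) (𝓡∂ (n + 1)) ∞ (Q.MC s) x :=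
  (Q.DA s).contMDiffAt_chartMap _ hx (by rw [Q.εB]; exact hxn)

/-- The two chart maps are inverse to each other (auxiliary form with an equality of saddles,
to rewrite under the dependent type of boxes). [folklore] -/
theorem chartMap_chartMap_of_eq {s₁ s₂ t : SaddlePt n g} (h : s₁ = s₂) {x : W}
    (hx : x ∈ (Q.DA s₁).chart.source) (hxn : ‖(Q.DA s₁).coord x‖ ≤ 3 * Q.ε) :
    (Q.DB t).chartMap (Q.DA s₂) ((Q.DA s₁).chartMap (Q.DB t) x) = x := by
  subst h
  exact (Q.DA s₁).chartMap_chartMap _ hx (by rw [Q.εB]; exact hxn)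

/-- **`MCi (σ s)` inverts `MC s`** on the `3ε`-ball. [folklore] -/
theorem MCi_MC (hx : x ∈ (Q.DA s).chart.source) (hxn : ‖(Q.DA s).coord x‖ ≤ 3 * Q.ε) :
    Q.MCi (Q.σ s) (Q.MC s x) = x :=
  Q.chartMap_chartMap_of_eq (Q.σ.symm_apply_apply s).symm hx hxn

/-- The other composite (auxiliary form). [folklore] -/
theorem chartMap_chartMap_of_eq' {t₁ t₂ s : SaddlePt n g} (h : t₁ = t₂) {y : W}
    (hy : y ∈ (Q.DB t₁).chart.source) (hyn : ‖(Q.DB t₁).coord y‖ ≤ 3 * Q.ε) :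
    (Q.DA s).chartMap (Q.DB t₂) ((Q.DB t₁).chartMap (Q.DA s) y) = y := by
  subst h
  exact (Q.DB t₁).chartMap_chartMap _ hy (by rw [Q.εA]; exact hyn)

/-- **`MC (σ⁻¹ s')` inverts `MCi s'`** on the `3ε`-ball. [folklore] -/
theorem MC_MCi {s' : SaddlePt n g} {y : W} (hy : y ∈ (Q.DB s').chart.source)
    (hyn : ‖(Q.DB s').coord y‖ ≤ 3 * Q.ε) : Q.MC (Q.σ.symm s') (Q.MCi s' y) = y :=
  Q.chartMap_chartMap_of_eq' (Q.σ.apply_symm_apply s').symm hy hyn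

/-- **`MC` conjugates the two flows** as long as the `A`-orbit stays in the `3ε`-ball:
`MC (θ_A (t, z)) = θ_B (t, MC z)`. [cite: LeeSmoothManifolds2013, Prop. 9.13] -/
theorem MC_θ {z : W} {T₁ T₂ : ℝ} (hT₁ : T₁ ≤ 0) (hT₂ : 0 ≤ T₂)
    (hmem : ∀ t ∈ Icc T₁ T₂, P.A.θ (t, z) ∈ (Q.DA s).chartBall (3 * Q.ε)) {t : ℝ} (ht : t ∈ Icc T₁ T₂) :
    Q.MC s (P.A.θ (t, z)) = P.B.θ (t, Q.MC s z) := by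
  have hmem' : ∀ t ∈ Icc T₁ T₂, P.A.θ (t, z) ∈ (Q.DA s).chartBall (3 * (Q.DB (Q.σ s)).ε) := by
    rw [Q.εB]; exact hmem
  exact P.A.isFlowOf_X.milnorBox_chartMap_apply_eq P.B.isFlowOf_X P.B.contMDiff_X_one (Q.DA s) (Q.DB (Q.σ s))
    (Q.k_eq s).symm hT₁ hT₂ hmem' ht

/-! ### Swapping -/

/-- **The saddle data of the swapped pair**: boxes exchanged, `σ` inverted. [folklore] -/
def swap : P.swap.SaddleData where
  c := Q.c
  apply_eq_c := Q.apply_eq_c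
  ε := Q.ε
  ε_pos := Q.ε_pos
  DA := Q.DB
  DB := Q.DA
  εA := Q.εB
  εB := Q.εA
  σ := Q.σ.symm
  k_eq s := by
    have h := Q.k_eq (Q.σ.symm s)
    rw [Q.σ.apply_symm_apply] at h
    exact h.symm
  sph_lt := by rw [BasinPair.swap_A, P.sph_eq]; exact Q.sph_lt
  lt_collar := by rw [BasinPair.swap_A, P.a'_eq]; exact Q.lt_collar
  intA := Q.intB
  intB := Q.intA
  disjA := Q.disjB
  disjB := Q.disjA

/-- The swapped data have the same value `c`. [folklore] -/
@[simp] theorem swap_c : Q.swap.c = Q.c := rfl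

/-- The swapped data have the same size. [folklore] -/
@[simp] theorem swap_ε : Q.swap.ε = Q.ε := rfl

/-- The swapped `A`-boxes are the `B`-boxes. [folklore] -/
@[simp] theorem swap_DA (s : SaddlePt n g) : Q.swap.DA s = Q.DB s := rfl

/-- The swapped `B`-boxes are the `A`-boxes. [folklore] -/
@[simp] theorem swap_DB (s : SaddlePt n g) : Q.swap.DB s = Q.DA s := rfl

/-- The swapped correspondence is the inverse. [folklore] -/
@[simp] theorem swap_σ : Q.swap.σ = Q.σ.symm := rfl

/-- **The model conjugation of the swapped data is `MCi`.** [folklore] -/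
theorem swap_MC (s' : SaddlePt n g) (y : W) : Q.swap.MC s' y = Q.MCi s' y := rfl

/-- Swapping twice gives back the data. [folklore] -/
theorem swap_swap_MC (s : SaddlePt n g) (x : W) : Q.swap.swap.MC s x = Q.MC s x := rfl

end SaddleData

end BasinPair

end Literature.Topology.FourManifolds
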